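import Summits.CriticalPhenomena.CardyFormulaZ2.Theorems.CardyFlipRussoVoronoiHubFromSmirnovStubMeckeRussoPairs

/-!
# Stub `stub_meckeRusso` (S1) of line `moebius-exact-delaunay-dilation-ward` — the Mecke–Russo
# identity along the linear density path (crux `VoronoiHubFromSmirnov`, stmt-CriticalPhenomena-6433)

Closing file of S1: `theorem stub_meckeRusso : Sig.stub_meckeRusso`.  Along the path
`ρ_t = 1 + t (ρ - 1)`, `t ∈ [0,1]`, the intensity `intensity ρ t δ` (density `ρ_t(δ z)`) splits as
`κ_{t,t'} + (t' - t) β⁺` at time `t'` and `κ_{t,t'} + (t' - t) β⁻` at time `t`, where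
`β^± = (ρ(δ z) - 1)^± dz` are FINITE atomless measures (compact support of `ρ - 1`) and
`κ_{t,t'}` has the continuous nonnegative density `1 + t (ρ(δz) - 1)⁺ - t' (ρ(δz) - 1)⁻`
(`intensity_eq_base_add`).  The two-colour expansion `expansion_pair` (file `…Pairs`, from the
Mecke equation) around the common base `κ_{t,t'}` then gives, for the annealed crossing
probability `f(t) = crossProb ρ t R δ` and `g(t) = ∫ (ρ(δz) - 1) insResp ρ t R δ z dz`,
`|f(t') - f(t) - (t'-t) g(t)| ≤ K (t'-t)²`, `|g(t') - g(t)| ≤ K (t'-t)`, `|g| ≤ K`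
(`step_estimates`), and the calculus lemma `integral_eq_sub_of_sq_increments` integrates this to
`f(1) - f(0) = ∫₀¹ g` — the Margulis–Russo / perturbation formula of Last–Penrose 2017 Thm 19.1
(signed perturbations: Last 2014 Thm 3.2) for the pair of independent Poisson processes.
-/

noncomputable section

namespace Summit.CriticalPhenomena.CardyFormulaZ2.Cruxes.VoronoiHubFromSmirnov.MoebiusExactDelaunayDilationWard

open scoped Topology ENNReal Interval
open Filter Set MeasureTheory
open Literature.Analysis.FunctionSpaces
open Literature.Probability.RandomPlanarGeometry

/-! ### Absolutely continuous intensities: finiteness, atoms, splitting -/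

/-- A continuous compactly supported density gives a finite measure. [folklore] -/
theorem withDensity_univ_ne_top {φ : ℂ → ℝ} (hφ : Continuous φ) (hφs : HasCompactSupport φ) :
    (volume.withDensity fun z => ENNReal.ofReal (φ z)) univ ≠ ∞ := by
  rw [withDensity_apply _ MeasurableSet.univ, Measure.restrict_univ]
  exact (hφ.integrable_of_hasCompactSupport hφs).lintegral_lt_top.ne

/-- Scaled absolutely continuous measures on `ℂ` are finite and atomless, with the expected total
mass. [folklore] -/
theorem smul_withDensity_facts {φ : ℂ → ℝ} (hφ : Continuous φ) (hφs : HasCompactSupport φ)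
    {c : ℝ} (hc : 0 ≤ c) :
    (ENNReal.ofReal c • volume.withDensity fun z => ENNReal.ofReal (φ z)) univ ≠ ∞ ∧
    (∀ x, (ENNReal.ofReal c • volume.withDensity fun z => ENNReal.ofReal (φ z)) {x} = 0) ∧
    (ENNReal.ofReal c • volume.withDensity fun z => ENNReal.ofReal (φ z)).real univ
      = c * (volume.withDensity fun z => ENNReal.ofReal (φ z)).real univ := by
  refine ⟨?_, fun x => ?_, ?_⟩
  · rw [Measure.smul_apply, smul_eq_mul]
    exact ENNReal.mul_ne_top ENNReal.ofReal_ne_top (withDensity_univ_ne_top hφ hφs)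
  · rw [Measure.smul_apply, smul_eq_mul, withDensity_absolutelyContinuous _ _ (measure_singleton x),
      mul_zero]
  · rw [measureReal_ennreal_smul_apply, ENNReal.toReal_ofReal hc]

/-- Splitting an absolutely continuous measure: `u dz = ψ dz + c · φ dz` when `u = ψ + c φ`
pointwise with `ψ, φ ≥ 0`, `c ≥ 0`. [folklore] -/
theorem withDensity_ofReal_split {u ψ φ : ℂ → ℝ} (hψm : Measurable ψ) (hφm : Measurable φ) {c : ℝ}
    (hc : 0 ≤ c) (hψ0 : ∀ z, 0 ≤ ψ z) (hφ0 : ∀ z, 0 ≤ φ z) (hu : ∀ z, u z = ψ z + c * φ z) :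
    (volume.withDensity fun z => ENNReal.ofReal (u z))
      = (volume.withDensity fun z => ENNReal.ofReal (ψ z))
        + ENNReal.ofReal c • volume.withDensity fun z => ENNReal.ofReal (φ z) := by
  rw [← withDensity_smul _ hφm.ennreal_ofReal, ← withDensity_add_left hψm.ennreal_ofReal]
  congr 1
  funext z
  simp only [Pi.add_apply, Pi.smul_apply, smul_eq_mul]
  rw [← ENNReal.ofReal_mul hc, ← ENNReal.ofReal_add (hψ0 z) (mul_nonneg hc (hφ0 z)), hu z]

/-- **Splitting of the path intensities around a common base.** For `0 ≤ t ≤ t' ≤ 1` and a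
positive profile `ρ`, with `w = ρ(δ·) - 1`:
`intensity ρ t' δ = κ + (t'-t) w⁺ dz` and `intensity ρ t δ = κ + (t'-t) w⁻ dz`, where `κ` has
density `1 + t w⁺ - t' w⁻ ≥ 0`. [folklore] -/
theorem intensity_eq_base_add {ρ : ℂ → ℝ} (hρc : Continuous ρ) (hpos : ∀ x, 0 < ρ x) (δ : ℝ)
    {t t' : ℝ} (h0 : 0 ≤ t) (htt' : t ≤ t') (h1 : t' ≤ 1) :
    intensity ρ t' δ
        = (volume.withDensity fun z => ENNReal.ofReal
            (1 + t * max (ρ ((δ : ℂ) * z) - 1) 0 - t' * max (1 - ρ ((δ : ℂ) * z)) 0))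
          + ENNReal.ofReal (t' - t) • (volume.withDensity fun z =>
              ENNReal.ofReal (max (ρ ((δ : ℂ) * z) - 1) 0)) ∧
      intensity ρ t δ
        = (volume.withDensity fun z => ENNReal.ofReal
            (1 + t * max (ρ ((δ : ℂ) * z) - 1) 0 - t' * max (1 - ρ ((δ : ℂ) * z)) 0))
          + ENNReal.ofReal (t' - t) • (volume.withDensity fun z =>
              ENNReal.ofReal (max (1 - ρ ((δ : ℂ) * z)) 0)) := by
  have hρδ : Continuous fun z : ℂ => ρ ((δ : ℂ) * z) := hρc.comp (continuous_const.mul continuous_id)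
  have hψm : Measurable fun z : ℂ =>
      1 + t * max (ρ ((δ : ℂ) * z) - 1) 0 - t' * max (1 - ρ ((δ : ℂ) * z)) 0 :=
    ((continuous_const.add (continuous_const.mul ((hρδ.sub continuous_const).max
      continuous_const))).sub (continuous_const.mul ((continuous_const.sub hρδ).max
      continuous_const))).measurable
  have hφpm : Measurable fun z : ℂ => max (ρ ((δ : ℂ) * z) - 1) 0 :=
    ((hρδ.sub continuous_const).max continuous_const).measurable
  have hφmm : Measurable fun z : ℂ => max (1 - ρ ((δ : ℂ) * z)) 0 :=
    ((continuous_const.sub hρδ).max continuous_const).measurable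
  have hψ0 : ∀ z : ℂ, 0 ≤ 1 + t * max (ρ ((δ : ℂ) * z) - 1) 0 - t' * max (1 - ρ ((δ : ℂ) * z)) 0 := by
    intro z
    have hρz := hpos ((δ : ℂ) * z)
    rcases le_total (ρ ((δ : ℂ) * z)) 1 with hle | hle
    · rw [max_eq_right (by linarith), max_eq_left (by linarith)]
      nlinarith
    · rw [max_eq_left (by linarith), max_eq_right (by linarith)]
      nlinarith
  constructor
  · refine withDensity_ofReal_split hψm hφpm (sub_nonneg.2 htt') hψ0 (fun z => le_max_right _ _)
      fun z => ?_
    simp only [densityPath]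
    rcases le_total (ρ ((δ : ℂ) * z)) 1 with hle | hle
    · rw [max_eq_right (by linarith), max_eq_left (by linarith)]
      ring
    · rw [max_eq_left (by linarith), max_eq_right (by linarith)]
      ring
  · refine withDensity_ofReal_split hψm hφmm (sub_nonneg.2 htt') hψ0 (fun z => le_max_right _ _)
      fun z => ?_
    simp only [densityPath]
    rcases le_total (ρ ((δ : ℂ) * z)) 1 with hle | hle
    · rw [max_eq_right (by linarith), max_eq_left (by linarith)]
      ring
    · rw [max_eq_left (by linarith), max_eq_right (by linarith)]
      ring

/-! ### The step estimates along the path -/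

/-- Integrating the insertion response of a probability law on pairs against a scaled absolutely
continuous measure `c · φ dz` (`φ ≥ 0` continuous compactly supported). [folklore] -/
theorem integral_insResp_smul_withDensity (M : Measure (PointConfig ℂ × PointConfig ℂ))
    (S : Set (PointConfig ℂ × PointConfig ℂ)) {φ : ℂ → ℝ} (hφ : Continuous φ) (hφ0 : ∀ z, 0 ≤ φ z) {c : ℝ} (hc : 0 ≤ c) :
    ∫ z, (M.real {p | (insertAt z p.1, p.2) ∈ S} + M.real {p | (p.1, insertAt z p.2) ∈ S}
        - 2 * M.real S) ∂(ENNReal.ofReal c • volume.withDensity fun z => ENNReal.ofReal (φ z))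
      = c * ∫ z, φ z * (M.real {p | (insertAt z p.1, p.2) ∈ S}
          + M.real {p | (p.1, insertAt z p.2) ∈ S} - 2 * M.real S) := by
  rw [integral_smul_measure, ENNReal.toReal_ofReal hc, smul_eq_mul,
    integral_withDensity_eq_integral_toReal_smul hφ.measurable.ennreal_ofReal
      (Eventually.of_forall fun z => ENNReal.ofReal_lt_top)]
  congr 1
  refine integral_congr_ae (Eventually.of_forall fun z => ?_)
  simp only [smul_eq_mul]
  rw [ENNReal.toReal_ofReal (hφ0 z)]

/-- **The step estimates** (Last–Penrose 2017 Thm 19.1 along the linear density path, for the pair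
of independent Poisson processes): with `f(t) = crossProb ρ t R δ` and
`g(t) = ∫ (ρ(δz) - 1) insResp ρ t R δ z dz` there is `K` with
`|f(t') - f(t) - (t'-t) g(t)| ≤ K (t'-t)²`, `|g(t') - g(t)| ≤ K (t'-t)` and `|g(t)| ≤ K` for
`0 ≤ t ≤ t' ≤ 1`. [cite: LastPenrose2017, Thm 19.1] -/
theorem step_estimates {ρ : ℂ → ℝ} (hρ : AdmissibleDensity ρ) (R : ConformalRectangle) {δ : ℝ}
    (hδ : 0 < δ) (hE : MeasurableSet (crossEvent R δ)) :
    ∃ K : ℝ, ∀ t t', 0 ≤ t → t ≤ t' → t' ≤ 1 →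
      |crossProb ρ t' R δ - crossProb ρ t R δ
          - (t' - t) * ∫ z, (ρ ((δ : ℂ) * z) - 1) * insResp ρ t R δ z| ≤ K * (t' - t) ^ 2 ∧
      |(∫ z, (ρ ((δ : ℂ) * z) - 1) * insResp ρ t' R δ z)
          - ∫ z, (ρ ((δ : ℂ) * z) - 1) * insResp ρ t R δ z| ≤ K * (t' - t) ∧
      |∫ z, (ρ ((δ : ℂ) * z) - 1) * insResp ρ t R δ z| ≤ K := by
  have hρc : Continuous ρ := hρ.continuous
  have hρδ : Continuous fun z : ℂ => ρ ((δ : ℂ) * z) := hρc.comp (continuous_const.mul continuous_id)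
  -- the weight and its positive / negative parts
  set w : ℂ → ℝ := fun z => ρ ((δ : ℂ) * z) - 1 with hw_def
  have hwz : ∀ z, ρ ((δ : ℂ) * z) - 1 = w z := fun z => rfl
  simp only [hwz]
  have hw : Continuous w := hρδ.sub continuous_const
  have hws : HasCompactSupport w := hasCompactSupport_comp_mul hρ.2.1 hδ.ne'
  set φp : ℂ → ℝ := fun z => max (ρ ((δ : ℂ) * z) - 1) 0 with hφp_def
  set φm : ℂ → ℝ := fun z => max (1 - ρ ((δ : ℂ) * z)) 0 with hφm_def
  have hφp : Continuous φp := (hρδ.sub continuous_const).max continuous_const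
  have hφm : Continuous φm := (continuous_const.sub hρδ).max continuous_const
  have hφps : HasCompactSupport φp := hws.comp_left (g := fun r : ℝ => max r 0) (by simp)
  have hφms : HasCompactSupport φm := by
    have : φm = (fun r : ℝ => max (-r) 0) ∘ w := by
      funext z
      simp only [Function.comp_apply, hφm_def, hw_def, neg_sub]
    rw [this]
    exact hws.comp_left (by simp)
  have hφpw : ∀ z, φp z - φm z = w z := fun z => by
    simp only [hφp_def, hφm_def, hw_def]
    rw [show (1 - ρ ((δ : ℂ) * z)) = -(ρ ((δ : ℂ) * z) - 1) by ring]
    exact max_zero_sub_max_neg_zero_eq_self _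
  set βp : Measure ℂ := volume.withDensity fun z => ENNReal.ofReal (φp z) with hβp_def
  set βm : Measure ℂ := volume.withDensity fun z => ENNReal.ofReal (φm z) with hβm_def
  set Bp := βp.real univ with hBp_def
  set Bm := βm.real univ with hBm_def
  have hBp : 0 ≤ Bp := measureReal_nonneg
  have hBm : 0 ≤ Bm := measureReal_nonneg
  set W := ∫ z, |w z| with hW_def
  have hW : 0 ≤ W := integral_nonneg fun z => abs_nonneg _
  have hwi : Integrable fun z => |w z| := (hw.integrable_of_hasCompactSupport hws).abs
  refine ⟨8 * Bp ^ 2 + 8 * Bm ^ 2 + 8 * W * Bm + 8 * W * (Bp + Bm) + 2 * W, ?_⟩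
  intro t t' h0 htt' h1
  set c := t' - t with hc_def
  have hc : 0 ≤ c := sub_nonneg.2 htt'
  -- the common base
  set ψ : ℂ → ℝ := fun z => 1 + t * max (ρ ((δ : ℂ) * z) - 1) 0 - t' * max (1 - ρ ((δ : ℂ) * z)) 0
    with hψ_def
  have hψc : Continuous ψ :=
    (continuous_const.add (continuous_const.mul hφp)).sub (continuous_const.mul hφm)
  set base : Measure ℂ := volume.withDensity fun z => ENNReal.ofReal (ψ z) with hbase_def
  set Pb := poissonLaw base with hPb_def
  have hPb : IsPoissonPointProcess base Pb := isPoissonPointProcess_poissonLaw_withDensity ψ hψc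
  haveI := hPb.isProbabilityMeasure
  obtain ⟨I1, I2⟩ := intensity_eq_base_add hρc hρ.2.2 δ h0 htt' h1
  set Qp := poissonLaw (intensity ρ t' δ) with hQp_def
  set Qm := poissonLaw (intensity ρ t δ) with hQm_def
  have hQp : IsPoissonPointProcess (base + ENNReal.ofReal c • βp) Qp := by
    have h := (show IsPoissonPointProcess (intensity ρ t' δ) Qp from
      isPoissonPointProcess_poissonLaw_intensity ρ hρc t' δ)
    rw [I1] at h
    exact h
  have hQm : IsPoissonPointProcess (base + ENNReal.ofReal c • βm) Qm := by
    have h := (show IsPoissonPointProcess (intensity ρ t δ) Qm from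
      isPoissonPointProcess_poissonLaw_intensity ρ hρc t δ)
    rw [I2] at h
    exact h
  haveI := hQp.isProbabilityMeasure
  haveI := hQm.isProbabilityMeasure
  obtain ⟨hpfin, hp0, hpmass⟩ := smul_withDensity_facts hφp hφps hc
  obtain ⟨hmfin, hm0, hmmass⟩ := smul_withDensity_facts hφm hφms hc
  obtain ⟨Ep1, -, Ep3⟩ := expansion_pair hpfin hp0 hPb hQp hE
  obtain ⟨Em1, -, Em3⟩ := expansion_pair hmfin hm0 hPb hQm hE
  rw [hpmass] at Ep1 Ep3
  rw [hmmass] at Em1 Em3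
  -- the base insertion response
  set IRb : ℂ → ℝ := fun z => (Pb.prod Pb).real {p | (insertAt z p.1, p.2) ∈ crossEvent R δ}
    + (Pb.prod Pb).real {p | (p.1, insertAt z p.2) ∈ crossEvent R δ}
    - 2 * (Pb.prod Pb).real (crossEvent R δ) with hIRb_def
  have hIRbm : Measurable IRb := measurable_insResp_gen (Pb.prod Pb) hE
  have hIRb2 : ∀ z, |IRb z| ≤ 2 := abs_insResp_gen_le_two (Pb.prod Pb) (crossEvent R δ)
  have hIRm : ∀ s, Measurable (insResp ρ s R δ) := fun s => measurable_insResp ρ hρc s R δ hE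
  have hIR2 : ∀ s z, |insResp ρ s R δ z| ≤ 2 := fun s z => abs_insResp_le_two ρ hρc s R δ z
  -- identification of the line's quantities
  have ef' : crossProb ρ t' R δ = (Qp.prod Qp).real (crossEvent R δ) := rfl
  have ef : crossProb ρ t R δ = (Qm.prod Qm).real (crossEvent R δ) := rfl
  have eIR' : ∀ z, insResp ρ t' R δ z = (Qp.prod Qp).real {p | (insertAt z p.1, p.2) ∈ crossEvent R δ}
      + (Qp.prod Qp).real {p | (p.1, insertAt z p.2) ∈ crossEvent R δ}
      - 2 * (Qp.prod Qp).real (crossEvent R δ) := fun z => rfl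
  have eIR : ∀ z, insResp ρ t R δ z = (Qm.prod Qm).real {p | (insertAt z p.1, p.2) ∈ crossEvent R δ}
      + (Qm.prod Qm).real {p | (p.1, insertAt z p.2) ∈ crossEvent R δ}
      - 2 * (Qm.prod Qm).real (crossEvent R δ) := fun z => rfl
  have dIR' : ∀ z, |insResp ρ t' R δ z - IRb z| ≤ 8 * (c * Bp) := fun z => by
    rw [eIR']; exact Ep3 z
  have dIR : ∀ z, |insResp ρ t R δ z - IRb z| ≤ 8 * (c * Bm) := fun z => by
    rw [eIR]; exact Em3 z
  -- the first-order terms as Lebesgue integrals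
  have eIp : ∫ z, IRb z ∂(ENNReal.ofReal c • βp) = c * ∫ z, φp z * IRb z :=
    integral_insResp_smul_withDensity (Pb.prod Pb) (crossEvent R δ) hφp (fun z => le_max_right _ _) hc
  have eIm : ∫ z, IRb z ∂(ENNReal.ofReal c • βm) = c * ∫ z, φm z * IRb z :=
    integral_insResp_smul_withDensity (Pb.prod Pb) (crossEvent R δ) hφm (fun z => le_max_right _ _) hc
  have hIpi : Integrable fun z => φp z * IRb z :=
    integrable_mul_of_continuous_of_bounded hφp hφps hIRbm hIRb2
  have hImi : Integrable fun z => φm z * IRb z :=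
    integrable_mul_of_continuous_of_bounded hφm hφms hIRbm hIRb2
  have eGb : (∫ z, φp z * IRb z) - ∫ z, φm z * IRb z = ∫ z, w z * IRb z := by
    rw [← integral_sub hIpi hImi]
    refine integral_congr_ae (Eventually.of_forall fun z => ?_)
    simp only
    rw [← sub_mul, hφpw]
  -- comparison of weighted integrals
  have hwI : ∀ s, Integrable fun z => w z * insResp ρ s R δ z := fun s =>
    integrable_mul_of_continuous_of_bounded hw hws (hIRm s) (hIR2 s)
  have hwIb : Integrable fun z => w z * IRb z :=
    integrable_mul_of_continuous_of_bounded hw hws hIRbm hIRb2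
  have cmp : ∀ (u v : ℂ → ℝ) (C : ℝ), Integrable (fun z => w z * u z) → Integrable (fun z => w z * v z) →
      (∀ z, |u z - v z| ≤ C) → |(∫ z, w z * u z) - ∫ z, w z * v z| ≤ W * C := by
    intro u v C hu hv huv
    rw [← integral_sub hu hv, ← Real.norm_eq_abs, hW_def, ← integral_mul_const]
    refine norm_integral_le_of_norm_le (hwi.mul_const C) (Eventually.of_forall fun z => ?_)
    rw [Real.norm_eq_abs, ← mul_sub, abs_mul]
    exact mul_le_mul_of_nonneg_left (huv z) (abs_nonneg _)
  have c1 : |(∫ z, w z * insResp ρ t R δ z) - ∫ z, w z * IRb z| ≤ W * (8 * (c * Bm)) :=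
    cmp _ _ _ (hwI t) hwIb dIR
  have c2 : |(∫ z, w z * insResp ρ t' R δ z) - ∫ z, w z * IRb z| ≤ W * (8 * (c * Bp)) :=
    cmp _ _ _ (hwI t') hwIb dIR'
  have c3 : |∫ z, w z * insResp ρ t R δ z| ≤ W * 2 := by
    rw [← Real.norm_eq_abs, hW_def, ← integral_mul_const]
    refine norm_integral_le_of_norm_le (hwi.mul_const 2) (Eventually.of_forall fun z => ?_)
    rw [Real.norm_eq_abs, abs_mul]
    exact mul_le_mul_of_nonneg_left (hIR2 t z) (abs_nonneg _)
  -- assembling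
  rw [eIp] at Ep1
  rw [eIm] at Em1
  rw [ef', ef]
  have hc1 : c ≤ 1 := by linarith
  refine ⟨?_, ?_, ?_⟩
  · have key : (Qp.prod Qp).real (crossEvent R δ) - (Qm.prod Qm).real (crossEvent R δ)
          - c * ∫ z, w z * insResp ρ t R δ z
        = ((Qp.prod Qp).real (crossEvent R δ) - (Pb.prod Pb).real (crossEvent R δ)
            - c * ∫ z, φp z * IRb z)
          - ((Qm.prod Qm).real (crossEvent R δ) - (Pb.prod Pb).real (crossEvent R δ)
            - c * ∫ z, φm z * IRb z)
          + c * ((∫ z, w z * IRb z) - ∫ z, w z * insResp ρ t R δ z) := by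
      rw [← eGb]; ring
    rw [key]
    have h3 : |c * ((∫ z, w z * IRb z) - ∫ z, w z * insResp ρ t R δ z)| ≤ c * (W * (8 * (c * Bm))) := by
      rw [abs_mul, abs_of_nonneg hc, abs_sub_comm]
      exact mul_le_mul_of_nonneg_left c1 hc
    calc _ ≤ |((Qp.prod Qp).real (crossEvent R δ) - (Pb.prod Pb).real (crossEvent R δ)
              - c * (∫ z, φp z * IRb z))
            - ((Qm.prod Qm).real (crossEvent R δ) - (Pb.prod Pb).real (crossEvent R δ)
              - c * (∫ z, φm z * IRb z))|
          + |c * ((∫ z, w z * IRb z) - ∫ z, w z * insResp ρ t R δ z)| := abs_add_le _ _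
      _ ≤ |(Qp.prod Qp).real (crossEvent R δ) - (Pb.prod Pb).real (crossEvent R δ)
              - c * (∫ z, φp z * IRb z)|
          + |(Qm.prod Qm).real (crossEvent R δ) - (Pb.prod Pb).real (crossEvent R δ)
              - c * (∫ z, φm z * IRb z)|
          + |c * ((∫ z, w z * IRb z) - ∫ z, w z * insResp ρ t R δ z)| := by
            linarith [abs_sub ((Qp.prod Qp).real (crossEvent R δ) - (Pb.prod Pb).real (crossEvent R δ)
              - c * (∫ z, φp z * IRb z)) ((Qm.prod Qm).real (crossEvent R δ)
              - (Pb.prod Pb).real (crossEvent R δ) - c * (∫ z, φm z * IRb z))]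
      _ ≤ 8 * (c * Bp) ^ 2 + 8 * (c * Bm) ^ 2 + c * (W * (8 * (c * Bm))) := by linarith [Ep1, Em1, h3]
      _ = (8 * Bp ^ 2 + 8 * Bm ^ 2 + 8 * W * Bm) * c ^ 2 := by ring
      _ ≤ _ := by
        apply mul_le_mul_of_nonneg_right _ (sq_nonneg c)
        nlinarith
  · rw [show (∫ z, w z * insResp ρ t' R δ z) - ∫ z, w z * insResp ρ t R δ z
        = ((∫ z, w z * insResp ρ t' R δ z) - ∫ z, w z * IRb z)
            - ((∫ z, w z * insResp ρ t R δ z) - ∫ z, w z * IRb z) by ring]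
    calc _ ≤ |(∫ z, w z * insResp ρ t' R δ z) - ∫ z, w z * IRb z|
          + |(∫ z, w z * insResp ρ t R δ z) - ∫ z, w z * IRb z| := abs_sub _ _
      _ ≤ W * (8 * (c * Bp)) + W * (8 * (c * Bm)) := add_le_add c2 c1
      _ = (8 * W * (Bp + Bm)) * c := by ring
      _ ≤ _ := by
        apply mul_le_mul_of_nonneg_right _ hc
        nlinarith
  · calc _ ≤ W * 2 := c3
      _ ≤ _ := by nlinarith

/-! ### The Mecke–Russo identity -/

/-- **S1 — the Mecke–Russo identity** (Last–Penrose 2017 Thm 19.1 / 19.3, perturbation formula,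
over the Mecke equation Thm 4.1 = `multivariateMecke_holds` at `m = 1`, superposition for the fixed
part of the intensity; signed perturbations as in Last 2014 Thm 3.2): along the linear density path
`ρ_t = 1 + t(ρ - 1)` the annealed crossing probability of the pair of independent Poisson–Voronoi
colour processes satisfies
`crossProb ρ 1 R δ - crossProb ρ 0 R δ = ∫₀¹ ∫ (ρ(δz) - 1) · insResp ρ t R δ z dz dt`,
with the space integrand integrable for every `t ∈ [0,1]`; given measurability of the crossing
event (S0). Proof: `step_estimates` + `integral_eq_sub_of_sq_increments`.
[cite: LastPenrose2017, Thm 19.1 and Thm 4.1] -/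
theorem stub_meckeRusso : Sig.stub_meckeRusso := by
  intro ρ hρ R δ hδ hE
  refine ⟨fun t ht => ?_, ?_⟩
  · exact integrable_weight_mul_insResp ρ hρ (fun x => ρ x - 1) (hρ.continuous.sub continuous_const)
      hρ.2.1 R δ hδ hE t ht
  · obtain ⟨K, hK⟩ := step_estimates hρ R hδ hE
    exact integral_eq_sub_of_sq_increments (f := fun t => crossProb ρ t R δ)
      (g := fun t => ∫ z, (ρ ((δ : ℂ) * z) - 1) * insResp ρ t R δ z) hK

end Summit.CriticalPhenomena.CardyFormulaZ2.Cruxes.VoronoiHubFromSmirnov.MoebiusExactDelaunayDilationWard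

end
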